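import Summits.CriticalPhenomena.SAWScalingLimit.Theorems.SAWRenewalTightnessSubseqIdentificationTiltedBracketCell
import HarnessLib

/-!
# The tilted martingale identities (line `boundary-area-law`, RS5b′/T2, Σ): the pieces of the bracket cell

Line `boundary-area-law` of the crux `SubseqIdentification` (stmt-CriticalPhenomena-0783), restriction
reshape (lead c4, r-c4-5), stub `stub_tiltedBracketMartingale` (Σ) = the bracket half of step (T2) of
the tilted [LSW] Theorem 6.5 (G. F. Lawler, O. Schramm, W. Werner, *Conformal restriction: the chordal
case*, J. Amer. Math. Soc. **16** (2003), §5 (5.1)–(5.3) and Prop. 5.3). Sequel of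
`…TiltedBracketCell`, bookkeeping for the cell estimate of `Zⁿ · Lᵏ` (`Zⁿ = (Mⁿ)² − κ Cⁿ`,
`Mⁿ = imgMartK κ hA hne n`, `Cⁿ = imgClockK κ hA hne n`, `Lᵏ = locMartK κ α λ hA hne k`):

* `brk_abs_le_and_stronglyMeasurable`, `integral_brkPast_mul_sub_eq_zero` — `Zⁿ_u` is bounded and
  `𝓕_u`-measurable, so the past term `𝟙_S Zⁿ_u (Lᵏ_{u+h} − Lᵏ_u)` integrates to zero exactly (`Lᵏ` is a
  martingale, `martingale_locMartK`);
* `integrable_brk_mul_locMartK`, `stronglyAdapted_brk_mul_locMartK` — `Zⁿ · Lᵏ` is bounded and adapted;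
* `brk_pieces` — for an `𝓕_u`-measurable weight `g ∈ [0, 1]` supported on `{u < imgLocTimeK n}`, the three
  main terms of the cell decomposition `indicator_brk_sub_eq` are integrable, and the `Y`-increment weight
  `g · Φ′_{B_u}(0)²` is again an `𝓕_u`-measurable weight in `[0, 1]` supported in the level-`n` controlled class
  (on the support `Φ′_{B_u}(0) = D̂ⁿ⁺¹_u`, an adapted process).

References: [LSW] §5 (5.1)–(5.3), Prop. 5.3. No named fact is used.
-/

noncomputable section

open MeasureTheory Filter Topology Set Metric Function
open scoped NNReal ENNReal
open Literature.Probability.RandomPlanarGeometry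
open Literature.Probability.Process (preWienerMeasure runSup runSup_nonneg integrable_runSup)

namespace Summit.CriticalPhenomena.SAWScalingLimit.Theorems.SubseqIdentification.BoundaryAreaLaw

open Loewner PathOps

/-! ### The past term has integral exactly zero -/

section Past

variable {κ : ℝ≥0} {α lam : ℝ} {A : Set ℂ} {hA : IsStarHull A} {hne : A.Nonempty} {n k : ℕ}

/-- `Zⁿ_u = (Mⁿ_u)² − κ Cⁿ_u` is bounded by `N₀² + κ u` and `𝓕_u`-strongly measurable. [folklore] -/
theorem brk_abs_le_and_stronglyMeasurable (u : ℝ≥0) :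
    (∃ N : ℝ, 0 ≤ N ∧ ∀ ω, |imgMartK κ hA hne n u ω ^ 2 - κ * imgClockK κ hA hne n u ω| ≤ N) ∧
      StronglyMeasurable[brownianFiltration u] (fun ω ↦ imgMartK κ hA hne n u ω ^ 2 - κ * imgClockK κ hA hne n u ω) := by
  obtain ⟨N, hN0, hN⟩ := exists_forall_abs_imgMartK_le (κ := κ) hA hne n
  refine ⟨⟨N ^ 2 + κ * u, by positivity, fun ω ↦ ?_⟩,
    (((stronglyAdapted_imgMartK (κ := κ) (hA := hA) (hne := hne) n) u).pow 2).sub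
      (((adapted_imgClockK (κ := κ) (hA := hA) (hne := hne) n u).const_mul (κ : ℝ)).stronglyMeasurable)⟩
  have h1 : |imgMartK κ hA hne n u ω ^ 2| ≤ N ^ 2 := by
    rw [abs_of_nonneg (sq_nonneg _), ← sq_abs]; exact pow_le_pow_left₀ (abs_nonneg _) (hN u ω) 2
  have h2 : |(κ : ℝ) * imgClockK κ hA hne n u ω| ≤ κ * u := by
    rw [abs_mul, abs_of_nonneg κ.coe_nonneg, abs_of_nonneg (imgClockK_nonneg n u ω)]
    exact mul_le_mul_of_nonneg_left (imgClockK_le n u ω) κ.coe_nonneg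
  exact (abs_sub _ _).trans (add_le_add h1 h2)

/-- **The past term integrates to zero**: for `s ≤ u`, `S ∈ 𝓕_s`,
`∫ 𝟙_S Zⁿ_u (Lᵏ_{u+h} − Lᵏ_u) = 0`, because `𝟙_S Zⁿ_u` is bounded and `𝓕_u`-measurable and `Lᵏ` is a
martingale (`martingale_locMartK`): `E[F L_{u+h}] = E[F · E[L_{u+h} | 𝓕_u]] = E[F L_u]`.
[cite: LawlerSchrammWerner2003Restriction, Prop. 5.3] -/
theorem integral_brkPast_mul_sub_eq_zero (hκ0 : 0 < κ) (hκ : κ ≤ 8 / 3) (hαdef : α = (6 - κ) / (2 * κ))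
    (hlamdef : lam = (8 - 3 * κ) * (6 - κ) / (2 * κ)) {s u h : ℝ≥0} (hsu : s ≤ u) {S : Set (ℝ≥0 → ℝ)}
    (hS : MeasurableSet[brownianFiltration s] S) :
    ∫ ω, S.indicator (fun _ ↦ (1 : ℝ)) ω * (imgMartK κ hA hne n u ω ^ 2 - κ * imgClockK κ hA hne n u ω) *
        (locMartK κ α lam hA hne k (u + h) ω - locMartK κ α lam hA hne k u ω) ∂preWienerMeasure = 0 := by
  -- adapted from …TiltedProductCell (`integral_prodPast_mul_sub_eq_zero`)
  haveI := isProbabilityMeasure_preWienerMeasure'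
  obtain ⟨hαpos, hlam0⟩ := exponents_pos hκ hαdef hlamdef hκ0
  have hmart : Martingale (locMartK κ α lam hA hne k) brownianFiltration preWienerMeasure :=
    martingale_locMartK hκ0 hκ hαdef hlamdef
  obtain ⟨⟨N, hN0, hN⟩, hZm⟩ := brk_abs_le_and_stronglyMeasurable (κ := κ) (hA := hA) (hne := hne) (n := n) u
  set F : (ℝ≥0 → ℝ) → ℝ := fun ω ↦ S.indicator (fun _ ↦ (1 : ℝ)) ω *
    (imgMartK κ hA hne n u ω ^ 2 - κ * imgClockK κ hA hne n u ω) with hF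
  have hFm : StronglyMeasurable[brownianFiltration u] F :=
    (stronglyMeasurable_const.indicator (brownianFiltration.mono hsu _ hS)).mul hZm
  have hFb : ∀ᵐ ω ∂preWienerMeasure, ‖F ω‖ ≤ N := Eventually.of_forall fun ω ↦ by
    rw [Real.norm_eq_abs, hF]; simp only
    rw [abs_mul]
    by_cases hω : ω ∈ S
    · rw [Set.indicator_of_mem hω, abs_one, one_mul]; exact hN ω
    · rw [Set.indicator_of_notMem hω, abs_zero, zero_mul]; exact hN0
  have hFm' : AEStronglyMeasurable F preWienerMeasure := (hFm.mono (brownianFiltration.le u)).aestronglyMeasurable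
  have iL : ∀ t, Integrable (locMartK κ α lam hA hne k t) preWienerMeasure := fun t ↦ integrable_locMartK hαpos hlam0 t
  have iFL : ∀ t, Integrable (F * locMartK κ α lam hA hne k t) preWienerMeasure := fun t ↦ (iL t).bdd_mul hFm' hFb
  have hm : brownianFiltration u ≤ (inferInstance : MeasurableSpace (ℝ≥0 → ℝ)) := brownianFiltration.le u
  haveI : IsFiniteMeasure (preWienerMeasure.trim hm) := isFiniteMeasure_trim hm
  have key : ∫ ω, (F * locMartK κ α lam hA hne k (u + h)) ω ∂preWienerMeasure =
      ∫ ω, (F * locMartK κ α lam hA hne k u) ω ∂preWienerMeasure := by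
    rw [← integral_condExp hm (f := F * locMartK κ α lam hA hne k (u + h))]
    refine integral_congr_ae ((condExp_mul_of_stronglyMeasurable_left hFm (iFL (u + h)) (iL (u + h))).trans ?_)
    filter_upwards [hmart.condExp_ae_eq (i := u) (j := u + h) le_self_add] with ω hω
    simp only [Pi.mul_apply]
    rw [hω]
  have e : (fun ω ↦ S.indicator (fun _ ↦ (1 : ℝ)) ω * (imgMartK κ hA hne n u ω ^ 2 - κ * imgClockK κ hA hne n u ω) *
      (locMartK κ α lam hA hne k (u + h) ω - locMartK κ α lam hA hne k u ω)) =
      fun ω ↦ (F * locMartK κ α lam hA hne k (u + h)) ω - (F * locMartK κ α lam hA hne k u) ω := by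
    funext ω; simp only [Pi.mul_apply, hF]; ring
  rw [e, integral_sub (iFL _) (iFL _), key, sub_self]

end Past

/-! ### The product process -/

section Product

variable {κ : ℝ≥0} {α lam : ℝ} {A : Set ℂ} {hA : IsStarHull A} {hne : A.Nonempty} {n k : ℕ}

/-- `Zⁿ_t · Lᵏ_t` is integrable (bounded: `|Zⁿ_t| ≤ N₀² + κt`, `Lᵏ ∈ [0, 1]`). [folklore] -/
theorem integrable_brk_mul_locMartK (hα : 0 < α) (hlam : 0 ≤ lam) (t : ℝ≥0) :
    Integrable (fun ω ↦ (imgMartK κ hA hne n t ω ^ 2 - κ * imgClockK κ hA hne n t ω) * locMartK κ α lam hA hne k t ω)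
      preWienerMeasure := by
  obtain ⟨⟨N, -, hN⟩, hZm⟩ := brk_abs_le_and_stronglyMeasurable (κ := κ) (hA := hA) (hne := hne) (n := n) t
  exact (integrable_locMartK hα hlam t).bdd_mul (hZm.mono (brownianFiltration.le t)).aestronglyMeasurable
    (Eventually.of_forall fun ω ↦ by rw [Real.norm_eq_abs]; exact hN ω)

/-- `Zⁿ · Lᵏ` is strongly adapted. [folklore] -/
theorem stronglyAdapted_brk_mul_locMartK (hα : 0 < α) :
    StronglyAdapted brownianFiltration
      (fun t ω ↦ (imgMartK κ hA hne n t ω ^ 2 - κ * imgClockK κ hA hne n t ω) * locMartK κ α lam hA hne k t ω) := fun t ↦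
  (brk_abs_le_and_stronglyMeasurable (κ := κ) (hA := hA) (hne := hne) (n := n) t).2.mul ((stronglyAdapted_locMartK hα) t)

end Product

/-! ### The pieces of the cell decomposition against a weight -/

section Pieces

variable [MeasurableSpace C(ℝ≥0, ℝ)] [BorelSpace C(ℝ≥0, ℝ)]
variable {κ : ℝ≥0} {α lam : ℝ} {A : Set ℂ} {hA : IsStarHull A} {hne : A.Nonempty} {n : ℕ}

/-- **The pieces of the bracket cell against an `𝓕_u`-weight.** For `g : Ω → [0, 1]` measurable for `𝓕_u` and
supported on `{u < imgLocTimeK n}` (`A ⊆ B̄(0, R)`, `α > 0`, `λ ≥ 0`), with `ΔW̃ = imageDrvFnK_{u+h} − imageDrvFnK_u`,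
`Ŷ′ = D_{u+h}^α e^{−λ∫ᵤ^{u+h} m}`, `d = Φ′_{B_u}(0)` along the Brownian path: `g ((ΔW̃)² Ŷ′ − κ d² d^α h)`,
`g ΔW̃ Ŷ′`, `2 (g Mⁿ_u) ΔW̃ Ŷ′` and `κ h (g d²)(Ŷ′ − d^α)` are integrable, and `g d²` is an `𝓕_u`-measurable
weight in `[0, 1]` supported where `A_u − W_u` is in the level-`n` class (alive, `B(0, cₙ)` off the hull,
`Φ′ ≥ cₙ`; on the support `d = D̂ⁿ⁺¹_u`, `controlled_of_lt_locTimeK`). [folklore] -/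
theorem brk_pieces (hα : 0 < α) (hlam : 0 ≤ lam) {R : ℝ} (hR0 : 0 < R) (hAR : A ⊆ closedBall (0 : ℂ) R) (u h : ℝ≥0)
    {g : (ℝ≥0 → ℝ) → ℝ} (hgmu : Measurable[brownianFiltration u] g) (hg01 : ∀ ω, g ω ∈ Icc (0 : ℝ) 1)
    (hgT : ∀ ω, g ω ≠ 0 → (u : WithTop ℝ≥0) < imgLocTimeK κ hA hne n ω) :
    Integrable (fun ω ↦ g ω * ((imageDrvFnK κ A (u + h) (brownianCPath ω) - imageDrvFnK κ A u (brownianCPath ω)) ^ 2 *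
          (DFnK κ A (u + h) (brownianCPath ω) ^ α * Real.exp (-(lam * JFnK κ A u h (brownianCPath ω)))) -
        κ * starDeriv (slidHull (drvK κ (brownianCPath ω)) A u) ^ 2 * starDeriv (slidHull (drvK κ (brownianCPath ω)) A u) ^ α * h))
        preWienerMeasure ∧
      Integrable (fun ω ↦ g ω * ((imageDrvFnK κ A (u + h) (brownianCPath ω) - imageDrvFnK κ A u (brownianCPath ω)) *
          (DFnK κ A (u + h) (brownianCPath ω) ^ α * Real.exp (-(lam * JFnK κ A u h (brownianCPath ω)))))) preWienerMeasure ∧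
      Integrable (fun ω ↦ 2 * (g ω * imgMartK κ hA hne n u ω) *
          ((imageDrvFnK κ A (u + h) (brownianCPath ω) - imageDrvFnK κ A u (brownianCPath ω)) *
            (DFnK κ A (u + h) (brownianCPath ω) ^ α * Real.exp (-(lam * JFnK κ A u h (brownianCPath ω)))))) preWienerMeasure ∧
      Measurable[brownianFiltration u] (fun ω ↦ g ω * starDeriv (slidHull (drvK κ (brownianCPath ω)) A u) ^ 2) ∧
      (∀ ω, g ω * starDeriv (slidHull (drvK κ (brownianCPath ω)) A u) ^ 2 ∈ Icc (0 : ℝ) 1) ∧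
      (∀ ω, g ω * starDeriv (slidHull (drvK κ (brownianCPath ω)) A u) ^ 2 ≠ 0 →
        Disjoint (closedHull (drvK κ (brownianCPath ω)) u) A ∧
          Disjoint (ball (0 : ℂ) (16 * (locLevel n / 16))) (slidHull (drvK κ (brownianCPath ω)) A u) ∧
            2 * (locLevel n / 2) ≤ starDeriv (slidHull (drvK κ (brownianCPath ω)) A u)) ∧
      Integrable (fun ω ↦ (κ : ℝ) * h * (g ω * starDeriv (slidHull (drvK κ (brownianCPath ω)) A u) ^ 2 *
          (DFnK κ A (u + h) (brownianCPath ω) ^ α * Real.exp (-(lam * JFnK κ A u h (brownianCPath ω))) -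
            starDeriv (slidHull (drvK κ (brownianCPath ω)) A u) ^ α))) preWienerMeasure := by
  have hκr : (0 : ℝ) ≤ κ := κ.coe_nonneg
  -- abbreviations
  set ΔΦ : (ℝ≥0 → ℝ) → ℝ := fun ω ↦ imageDrvFnK κ A (u + h) (brownianCPath ω) - imageDrvFnK κ A u (brownianCPath ω) with hΔΦ
  set Yh : (ℝ≥0 → ℝ) → ℝ := fun ω ↦ DFnK κ A (u + h) (brownianCPath ω) ^ α *
    Real.exp (-(lam * JFnK κ A u h (brownianCPath ω))) with hYh
  set d : (ℝ≥0 → ℝ) → ℝ := fun ω ↦ starDeriv (slidHull (drvK κ (brownianCPath ω)) A u) with hd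
  set Dh : (ℝ≥0 → ℝ) → ℝ := DhatpK κ hA hne (n + 1) u with hDh
  -- ranges and measurability
  have hgm : Measurable g := hgmu.mono (brownianFiltration.le u) le_rfl
  have hg1' : ∀ᵐ ω ∂preWienerMeasure, ‖g ω‖ ≤ 1 := Eventually.of_forall fun ω ↦ by
    rw [Real.norm_eq_abs, abs_of_nonneg (hg01 ω).1]; exact (hg01 ω).2
  have hYhm : Measurable Yh := (((measurable_DFnK hA hne (u + h)).comp measurable_brownianCPath).pow_const _).mul
    (((measurable_JFnK hA hne u h).comp measurable_brownianCPath).const_mul lam).neg.exp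
  have hYh01 : ∀ ω, Yh ω ∈ Icc (0 : ℝ) 1 := fun ω ↦ by
    obtain ⟨-, -, e0, e1⟩ := DFnK_eq (κ := κ) (A := A) (u + h) (brownianCPath ω)
    have c1 : Real.exp (-(lam * JFnK κ A u h (brownianCPath ω))) ≤ 1 := by
      rw [Real.exp_le_one_iff, neg_nonpos]; exact mul_nonneg hlam (JFnK_nonneg hA u h _)
    exact ⟨mul_nonneg (Real.rpow_nonneg e0 _) (Real.exp_pos _).le, mul_le_one₀ (Real.rpow_le_one e0 e1 hα.le) (Real.exp_pos _).le c1⟩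
  have hd01 : ∀ ω, 0 < d ω ∧ d ω ≤ 1 := fun ω ↦ starDeriv_pos_le_one _
  have hDhmu : Measurable[brownianFiltration u] Dh := adapted_DhatpK (κ := κ) (hA := hA) (hne := hne) (n + 1) u
  have hDhm : Measurable Dh := hDhmu.mono (brownianFiltration.le u) le_rfl
  have hDh01 : ∀ ω, 0 ≤ Dh ω ∧ Dh ω ≤ 1 := fun ω ↦ DhatFnK_mem_Icc (κ := κ) (hA := hA) (hne := hne) (n + 1) u (brownianCPath ω)
  -- on the support of `g`, `d = D̂ⁿ⁺¹_u`
  have hdD : ∀ ω, g ω ≠ 0 → d ω = Dh ω := fun ω h0 ↦ by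
    obtain ⟨-, -, hDeq, -, -⟩ := controlled_of_lt_locTimeK (lt_of_lt_of_le (hgT ω h0) (imgLocTimeK_le_locTimeK n ω))
    rw [hd, hDh]; exact hDeq.symm
  have hgd2 : (fun ω ↦ g ω * d ω ^ 2) = fun ω ↦ g ω * Dh ω ^ 2 := by
    funext ω
    by_cases h0 : g ω = 0
    · rw [h0, zero_mul, zero_mul]
    · rw [hdD ω h0]
  have hgdA : (fun ω ↦ g ω * (κ * d ω ^ 2 * d ω ^ α * h)) = fun ω ↦ g ω * (κ * Dh ω ^ 2 * Dh ω ^ α * h) := by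
    funext ω
    by_cases h0 : g ω = 0
    · rw [h0, zero_mul, zero_mul]
    · rw [hdD ω h0]
  have hbd1 : ∀ {f : (ℝ≥0 → ℝ) → ℝ} (c : ℝ), Measurable f → (∀ ω, |f ω| ≤ c) → Integrable f preWienerMeasure := fun c hf hb ↦
    (integrable_const c).mono' hf.aestronglyMeasurable (Eventually.of_forall fun ω ↦ by rw [Real.norm_eq_abs]; exact hb ω)
  obtain ⟨-, iΔ, iΔ2⟩ := integrable_imageDrv_subK (κ := κ) hA hne hR0 hAR u h
  have iP : Integrable (fun ω ↦ ΔΦ ω * Yh ω) preWienerMeasure :=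
    (iΔ.bdd_mul hYhm.aestronglyMeasurable (Eventually.of_forall fun ω ↦ by
      rw [Real.norm_eq_abs, abs_of_nonneg (hYh01 ω).1]; exact (hYh01 ω).2)).congr (Eventually.of_forall fun ω ↦ mul_comm _ _)
  have iP2 : Integrable (fun ω ↦ ΔΦ ω ^ 2 * Yh ω) preWienerMeasure :=
    (iΔ2.bdd_mul hYhm.aestronglyMeasurable (Eventually.of_forall fun ω ↦ by
      rw [Real.norm_eq_abs, abs_of_nonneg (hYh01 ω).1]; exact (hYh01 ω).2)).congr (Eventually.of_forall fun ω ↦ mul_comm _ _)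
  -- (1) the second-moment piece
  have iA2 : Integrable (fun ω ↦ g ω * (κ * d ω ^ 2 * d ω ^ α * h)) preWienerMeasure := by
    rw [hgdA]
    refine hbd1 (κ * h) (hgm.mul (((measurable_const.mul (hDhm.pow_const _)).mul (hDhm.pow_const _)).mul measurable_const)) fun ω ↦ ?_
    obtain ⟨e0, e1⟩ := hDh01 ω
    have f1 : Dh ω ^ 2 * Dh ω ^ α ≤ 1 := mul_le_one₀ (pow_le_one₀ e0 e1) (Real.rpow_nonneg e0 _) (Real.rpow_le_one e0 e1 hα.le)
    have f0 : 0 ≤ Dh ω ^ 2 * Dh ω ^ α := mul_nonneg (sq_nonneg _) (Real.rpow_nonneg e0 _)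
    rw [abs_mul, abs_of_nonneg (hg01 ω).1, show (κ : ℝ) * Dh ω ^ 2 * Dh ω ^ α * h = (κ * h) * (Dh ω ^ 2 * Dh ω ^ α) by ring,
      abs_of_nonneg (by positivity)]
    calc g ω * ((κ : ℝ) * h * (Dh ω ^ 2 * Dh ω ^ α)) ≤ 1 * (κ * h * 1) := by
          gcongr
          · exact (hg01 ω).2
      _ = κ * h := by ring
  have i1 : Integrable (fun ω ↦ g ω * (ΔΦ ω ^ 2 * Yh ω - κ * d ω ^ 2 * d ω ^ α * h)) preWienerMeasure :=
    ((iP2.bdd_mul hgm.aestronglyMeasurable hg1').sub iA2).congr (Eventually.of_forall fun ω ↦ by simp only [Pi.sub_apply]; ring)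
  -- (2), (3) the first-moment pieces
  have ig0 : Integrable (fun ω ↦ g ω * (ΔΦ ω * Yh ω)) preWienerMeasure := iP.bdd_mul hgm.aestronglyMeasurable hg1'
  obtain ⟨N₀, -, hN₀⟩ := exists_forall_abs_imgMartK_le (κ := κ) hA hne n
  have i2 : Integrable (fun ω ↦ 2 * (g ω * imgMartK κ hA hne n u ω) * (ΔΦ ω * Yh ω)) preWienerMeasure :=
    iP.bdd_mul ((measurable_const.mul (hgm.mul (measurable_imgMartK n u))).aestronglyMeasurable) (Eventually.of_forall fun ω ↦ by
      rw [Real.norm_eq_abs, abs_mul, abs_two, abs_mul, abs_of_nonneg (hg01 ω).1]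
      have := hN₀ u ω
      show 2 * (g ω * |imgMartK κ hA hne n u ω|) ≤ 2 * N₀
      nlinarith [(hg01 ω).2, abs_nonneg (imgMartK κ hA hne n u ω), (hg01 ω).1])
  -- (4) the `Y`-increment weight `g d²`
  have hg2mu : Measurable[brownianFiltration u] (fun ω ↦ g ω * d ω ^ 2) := by
    rw [hgd2]; exact hgmu.mul (hDhmu.pow_const _)
  have hg21 : ∀ ω, g ω * d ω ^ 2 ∈ Icc (0 : ℝ) 1 := fun ω ↦
    ⟨mul_nonneg (hg01 ω).1 (sq_nonneg _), mul_le_one₀ (hg01 ω).2 (sq_nonneg _) (pow_le_one₀ (hd01 ω).1.le (hd01 ω).2)⟩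
  have hg2supp : ∀ ω, g ω * d ω ^ 2 ≠ 0 → Disjoint (closedHull (drvK κ (brownianCPath ω)) u) A ∧
      Disjoint (ball (0 : ℂ) (16 * (locLevel n / 16))) (slidHull (drvK κ (brownianCPath ω)) A u) ∧
        2 * (locLevel n / 2) ≤ starDeriv (slidHull (drvK κ (brownianCPath ω)) A u) := fun ω hω ↦ by
    have h0 : g ω ≠ 0 := fun h0 ↦ hω (by rw [h0, zero_mul])
    obtain ⟨halive, -, -, hdl, hm⟩ := controlled_of_lt_locTimeK (lt_of_lt_of_le (hgT ω h0) (imgLocTimeK_le_locTimeK n ω))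
    refine ⟨halive, ?_, by linarith⟩
    rw [show 16 * (locLevel n / 16) = locLevel n by ring]
    exact disjoint_ball_infDist.mono_left (ball_subset_ball hm.le)
  have i3 : Integrable (fun ω ↦ (κ : ℝ) * h * (g ω * d ω ^ 2 * (Yh ω - d ω ^ α))) preWienerMeasure := by
    have hm : Measurable fun ω ↦ g ω * d ω ^ 2 * (Yh ω - d ω ^ α) := by
      have e : (fun ω ↦ g ω * d ω ^ 2 * (Yh ω - d ω ^ α)) = fun ω ↦ g ω * Dh ω ^ 2 * (Yh ω - Dh ω ^ α) := by
        funext ω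
        by_cases h0 : g ω = 0
        · rw [h0, zero_mul, zero_mul, zero_mul, zero_mul]
        · rw [hdD ω h0]
      rw [e]; exact (hgm.mul (hDhm.pow_const _)).mul (hYhm.sub (hDhm.pow_const _))
    refine (hbd1 1 hm fun ω ↦ ?_).const_mul _
    rw [abs_mul, abs_of_nonneg (hg21 ω).1]
    have : |Yh ω - d ω ^ α| ≤ 1 := by
      have := Real.rpow_nonneg (hd01 ω).1.le α; have := Real.rpow_le_one (hd01 ω).1.le (hd01 ω).2 hα.le
      rw [abs_le]; constructor <;> linarith [(hYh01 ω).1, (hYh01 ω).2]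
    exact mul_le_one₀ (hg21 ω).2 (abs_nonneg _) this
  exact ⟨i1, ig0, i2, hg2mu, hg21, hg2supp, i3⟩

end Pieces

section Registered

/-- **Registered form** (explicit binders) of `integrable_brk_mul_locMartK`: the product `Zⁿ_t · Lᵏ_t` of the
compensated square with the localised restriction martingale is integrable (`α > 0`, `λ ≥ 0`). [folklore] -/
theorem integrable_brk_mul_locMartK_registered :
    ∀ (κ : ℝ≥0) (α lam : ℝ) (A : Set ℂ) (hA : IsStarHull A) (hne : A.Nonempty) (n k : ℕ), 0 < α → 0 ≤ lam →
      ∀ (t : ℝ≥0), Integrable (fun ω => (imgMartK κ hA hne n t ω ^ 2 - κ * imgClockK κ hA hne n t ω) *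
        locMartK κ α lam hA hne k t ω) preWienerMeasure :=
  fun _ _ _ _ _ _ _ _ hα hlam t ↦ integrable_brk_mul_locMartK hα hlam t

end Registered

end Summit.CriticalPhenomena.SAWScalingLimit.Theorems.SubseqIdentification.BoundaryAreaLaw

end
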